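import Summits.QuantumFields.YangMills.Theorems.BalabanUVNodesN20KeyedRelWeightUnionReading
import Summits.QuantumFields.YangMills.Theorems.BalabanUVNodesN20OverAgeRefreshProcess

/-!
# BalabanUVNodes ∕ N20 (NE7b) — THE LOG MARGIN: the age-currency design rule with a LOGARITHMIC age floor (a `p`-series instead of a geometric one), the OVER-AGE booking of the crux
# cards at dag-n20-d's key-reading edition and at the NAMED forgiving key, and the cards' rate letter `r := L⁴·e^{−c}` (`κ₁·(c − 4 log L) > 1` verbatim)

Cell `pub-ymgap` (HUMAN RULING D-0062 Track A; work-bound push D-0149, director-ym №197), width seat `pub-ymgap-dag-n20-w2` (gen 4) on node N20 = NE7b; CLAIM-3 of the re-seat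
(this lineage's AGE socket — gen 3 `…Levels ∕ …LevelsLive ∕ …AtKeyReading ∕ …AtForgivingKey`, p606933 ∕ p609064 ∕ p610465 ∕ p617084 — read against the crux cards' over-age booking).
Filed `--kind proof --supports stmt-QuantumFields-20544 --as helper` (K3⁷ `SpineGivenEndpointR13SepCoPH`; skeleton v5 941dddb108cbaacf STANDS); COUNT-NEUTRAL; LOCATED.
[LF-I] = [Balaban1989LargeFieldI], [LF-II] = [Balaban1989LargeFieldII]; cards: `Cruxes/SpineGivenEndpointR13SepCoPH/Ideas/window-key-core.md` ((AC), K2) ∕ `…/hellinger-free-energy-road.md`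
((V-a)) ∕ `…/OVERAGE-RATE-READING-idea3-g13.md` (rev 3) ∕ `…/CRIT-1-REPRICE-hellinger-free-energy-road-ed5-overage.md`.

WHY.  The cards book, at the window key of run `K`, the classes carrying an OVER-AGED pending large-field region — pending beyond its (1.80) budget `bud` plus a margin `κ₁ log K` — and
read off [LF-II] pp.383–386 a one-run large-deviation letter: per over-age step a region pays activity `e^{−c}` against block entropy `L⁴`, so the booked mass is `≲ vol·ε̄·L^{4·bud}·
Σ_{m > j⋆(K)} (L⁴e^{−c})^m` with `j⋆(K) = bud + κ₁ log K`, summable over `K` iff `κ₁·(c − 4 log L) > 1` ((AC); `> 2` for (V-a)'s square roots).  In this lineage's vocabulary that booking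
IS gen 3's LEVEL-CUT reading «an un-absorbed birth at a level OLDER than the age floor `j⋆(K)`» (cut `jcut K := K₀ + K − j⋆(K)` at the component-forgiving key, p617084 §2), and the letter
IS gen 3's per-birth-level SURVIVAL letter with rate `r := L⁴·e^{−c}` — so the survival socket prices it: `W K ≤ V·r^{K₀+K−jcut K}∕(1−r)` (p617084 §1).  What p617084's design rule does
NOT cover is the cards' floor: it asks a LINEAR age floor (geometric summability), the cards have a LOGARITHMIC one (`κ₁ log K`), whose summability is a `p`-SERIES: `r^{κ₁ log K} =
K^{−κ₁ log(1∕r)}`, summable iff `κ₁·log(1∕r) > 1` — with `log(1∕r) = c − 4 log L` exactly the cards' condition (the `p`-series step is dag-n20-w5's `summable_of_le_exp_log`,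
p621610 `…N20OverAgeRefreshProcess`, cited).  This file types that rule AT THE READING (§1 arithmetic, §2 at the K-edition for ANY
step-preserving dial, §3 at the NAMED forgiving key = the over-age booking's typed home, plus the pending dial (P) of p622010 under a log floor) and the rate letter's dictionary (§1:
`L⁴e^{−c} < 1 ⟺ 4 log L < c`, `−log(L⁴e^{−c}) = c − 4 log L`).
CONTENTS (theorems only; 0 `def`):
* §1 (folklore) `pow_le_exp_neg_log_of_logFloor` (`κ·log K ≤ a ⇒ r^a ≤ e^{−κ log(1∕r)·log K}`) · ★ `summable_survival_of_logAgeFloor` (the `p`-series rule, via dag-n20-w5's `summable_of_le_exp_log` BY NAME) ·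
  `entropyActivityRate_lt_one_iff` · `neg_log_entropyActivityRate` · `logMargin_iff` (`1 < κ₁·(−log(L⁴e^{−c})) ⟺ 1 < κ₁·(c − 4 log L)`);
* §2 (K-edition, step-preserving dial, level-cut bad reading) ★★ `relWeightBound_crOfRecord₁₃KAt_of_survival` (generic: `V·r^{age floor} < 1 − r` ∀K + `Σ_K V·r^{age floor} < ∞`) · ★★
  `relWeightBound_crOfRecord₁₃KAt_of_survival_logAgeFloor` (minimal age `a₀` with `V·r^{a₀} < 1−r` + LOG age floor `κ·log K ≤ K₀+K−jcut K` with `κ·log(1∕r) > 1`);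
* §3 (at `forgiveCompReading₁₃ K₀ c`) ★★★ `relWeightBound_forgiveCompReading₁₃_of_survival_logAgeFloor` (THE CARDS' OVER-AGE BOOKING, typed: the face at the forgiving key from the survival
  letter at rate `r` and the log margin) · ★★★ `relWeightBound_forgiveCompReading₁₃_of_overAgeRate` (the same in the cards' own letters `L, c, κ₁`: `4 log L < c`,
  `1 < κ₁·(c − 4 log L)`) · `relWeightBound_crOfRecord₁₃KAt_pending_of_geometric_logAge` (p622010's pending dial (P) under a log age floor at rate `q^c`).
Cited BY NAME, not re-typed: p617084 §1 (`W_crOfRecord₁₃KAt_le_survival`), §2 (`forgiveKeyCompSigma_fst_eq`); p610465 §1 (`relWeightBound_crOfRecord₁₃KAt_iff`); p609064 §4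
(`survivalMajorant_lt_one_of_ageFloor`); p622010 §3 (`relWeightBound_crOfRecord₁₃KAt_pending_of_geometric`); dag-n20-d `…CoPHK ∕ …CoPHKForgive` (`crOfRecord₁₃KAt`, `badKeyReadingOfCut₁₃`,
`forgiveCompReading₁₃`); dag-n20-w5 `…N20OverAgeRefreshProcess` §3 (`summable_of_le_exp_log` — the (AC) exponent-1 `p`-series step; its §4 is the
cards' ONE-RUN wild-mass arithmetic over an abstract refresh process, which this file does not touch).

HONEST FRAMING.  [folklore] real-analysis bookkeeping BY NAME; the survival letter at rate `r = L⁴e^{−c}` is a HYPOTHESIS — the cards' DERIVED one-run large-deviation letter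
(`OVERAGE-RATE-READING` §3; CRIT-1 re-price: located, «a derived corollary of (1.79)–(1.85) under (KR)», not a quotation of Bałaban) made RELATIVE and two-run at the coarse carriers, i.e.
NE7b's body at the window key in the age currency — NAMED OPEN, NOT PRINTED for `d = 4`, NOT proved, inhabited here for no Bałaban family; NO weight bounded, NO estimate proved; `c`, `L`,
`κ₁`, `bud` are letters, not read from any record object.  Nothing of Bałaban's is asserted; NE7 ∕ NE7b ∕ NE7c NOT PRINTED for `d = 4`, NOT proved; (α)-instance 0∕1; no `Provisos₁₃CoPH`
inhabitant claimed (K0⁷ OPEN); N19 ∕ N20 ∕ N21 ∕ N27 NOT discharged; K3⁷ NOT closed (v5 stands; no dial ∕ bad reading ∕ margin is pinned by any registered text); counts unmoved (typed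
28∕28 · discharged 5∕27); no count claim (the chair's single count line is the only count).  One finite `𝕋⁴_{L^K}` programme at fixed `ε = L^{−K}`, Bałaban AS PRINTED; the YM mass gap
(Clay) is NOT proved by any of this — R4 closes the conditional finite-𝕋⁴ rung `BalabanLadder.UV` only; NOT ℝ⁴ ∕ infinite volume ∕ OS.  No `def` ∕ `instance` ∕ `notation` ∕ `sorry`.
Sources (locators only): [LF-II] Thm 1 + (0.1) pp.355–356, (1.79)–(1.85) pp.383–386, (1.89) p.387; [LF-I] (0.2) p.176, p.177; [King1986] (3.10)–(3.11) p.656.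
-/

noncomputable section

open scoped BigOperators
open _root_.Filter _root_.Topology

namespace Summit.QuantumFields.YangMills.BalabanUVNodes.N20KeyedRelWeightLogMargin

open Literature.MathematicalPhysics.QuantumFieldTheory.Balaban1983to89 Literature.MathematicalPhysics.QuantumFieldTheory.Balaban1983to89.Node00
open T4Continuum
open T4WeightBudget (RelWeightBound)
open YMDAG.UVSplit hiding SU
open Summit.QuantumFields.YangMills.BalabanUVNodes.SpineCanonicalWeights
open Summit.QuantumFields.YangMills.BalabanUVNodes.N20KeyedRelWeightLevelsLive (survivalMajorant_lt_one_of_ageFloor)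
open Summit.QuantumFields.YangMills.BalabanUVNodes.N20KeyedRelWeightAtKeyReading
open Summit.QuantumFields.YangMills.BalabanUVNodes.N20KeyedRelWeightAtForgivingKey
open Summit.QuantumFields.YangMills.BalabanUVNodes.N20KeyedRelWeightUnionReading
open Summit.QuantumFields.YangMills.BalabanUVNodes.N20OverAgeRefreshProcess (summable_of_le_exp_log)

variable {F : T4Family} {N : ℕ} [NeZero N]

/-! ## §1  Folklore: the `p`-series rule for a logarithmic age floor; the cards' rate letter `L⁴·e^{−c}` -/
section Folklore

/-- **A LOGARITHMIC FLOOR TURNS THE SURVIVAL FACTOR INTO A POWER OF THE STEP**: `0 < r < 1`, `κ·log K ≤ a` ⇒ `r^a ≤ e^{−(κ·(−log r))·log K}` (`= K^{−κ log(1∕r)}` for `K ≥ 1`).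
[cite: Balaban1989LargeFieldII, (1.80) p.384; King1986, (3.10)–(3.11) p.656 (bookkeeping)] -/
theorem pow_le_exp_neg_log_of_logFloor {r κ : ℝ} (h0 : 0 < r) (h1 : r < 1) {a : ℕ} (K : ℕ) (hfloor : κ * Real.log (K : ℝ) ≤ (a : ℝ)) :
    r ^ a ≤ Real.exp (-(κ * -Real.log r * Real.log (K : ℝ))) := by
  calc r ^ a = r ^ (a : ℝ) := (Real.rpow_natCast r a).symm
    _ ≤ r ^ (κ * Real.log (K : ℝ)) := Real.rpow_le_rpow_of_exponent_ge h0 h1.le hfloor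
    _ = Real.exp (-(κ * -Real.log r * Real.log (K : ℝ))) := by
        rw [Real.rpow_def_of_pos h0]
        congr 1
        ring

/-- **★ THE `p`-SERIES RULE — SUMMABILITY FROM A LOGARITHMIC AGE FLOOR**: survival rate `0 < r < 1`, entropy `V ≥ 0`, margin `1 < κ·(−log r)` (= `κ·log(1∕r)`), and an age floor
`κ·log K ≤ K₀ + K − jcut K` at every step (the cards' `j⋆(K) = bud + κ₁ log K`) ⇒ `K ↦ V·r^{K₀+K−jcut K}` is summable — by dag-n20-w5's `p`-series step
`…N20OverAgeRefreshProcess.summable_of_le_exp_log` ((AC)'s exponent-1 letter, p-series `Σ K^{−κ log(1∕r)}`), cited BY NAME.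
[cite: Balaban1989LargeFieldII, (1.80) p.384, (1.89) p.387; King1986, (3.10)–(3.11) p.656 (bookkeeping)] -/
theorem summable_survival_of_logAgeFloor {r V κ : ℝ} (h0 : 0 < r) (h1 : r < 1) (hV : 0 ≤ V) (hmargin : 1 < κ * -Real.log r) {K₀ : ℕ} {jcut : ℕ → ℕ}
    (hfloor : ∀ K : ℕ, κ * Real.log (K : ℝ) ≤ ((K₀ + K - jcut K : ℕ) : ℝ)) :
    Summable fun K => V * r ^ (K₀ + K - jcut K) :=
  summable_of_le_exp_log (C := V) hmargin _ (fun _ => mul_nonneg hV (pow_nonneg h0.le _)) fun K _ =>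
    mul_le_mul_of_nonneg_left (pow_le_exp_neg_log_of_logFloor h0 h1 K (hfloor K)) hV

/-- **THE CARDS' RATE LETTER**: block entropy `L⁴` per over-age step against activity `e^{−c}` — the survival rate `L⁴·e^{−c}` is `< 1` iff `4 log L < c` (`L > 0`).
[cite: Balaban1989LargeFieldII, (1.80) p.384, (1.85) p.386; Balaban1989LargeFieldI, p.177 (bookkeeping)] -/
theorem entropyActivityRate_lt_one_iff {L c : ℝ} (hL : 0 < L) : L ^ 4 * Real.exp (-c) < 1 ↔ 4 * Real.log L < c := by
  have hL4 : 0 < L ^ 4 := pow_pos hL 4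
  rw [← Real.log_neg_iff (mul_pos hL4 (Real.exp_pos _)), Real.log_mul hL4.ne' (Real.exp_pos _).ne', Real.log_exp, Real.log_pow]
  constructor <;> intro h <;> push_cast at h ⊢ <;> linarith

/-- **… AND ITS LOG IS THE MARGIN RATE**: `−log(L⁴·e^{−c}) = c − 4 log L` (`L > 0`). [cite: Balaban1989LargeFieldII, (1.80) p.384, (1.85) p.386 (bookkeeping)] -/
theorem neg_log_entropyActivityRate {L : ℝ} (c : ℝ) (hL : 0 < L) : -Real.log (L ^ 4 * Real.exp (-c)) = c - 4 * Real.log L := by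
  rw [Real.log_mul (pow_pos hL 4).ne' (Real.exp_pos _).ne', Real.log_exp, Real.log_pow]
  push_cast
  ring

/-- **THE CARDS' SUMMABILITY CONDITION VERBATIM**: with `r := L⁴·e^{−c}` the `p`-series margin `1 < κ₁·(−log r)` reads `1 < κ₁·(c − 4 log L)` ((AC) of `window-key-core`; (V-a) of
`hellinger-free-energy-road` asks `2 <` for its square roots). [cite: Balaban1989LargeFieldII, (1.80) p.384, (1.85) p.386 (bookkeeping)] -/
theorem logMargin_iff {L c κ₁ : ℝ} (hL : 0 < L) : 1 < κ₁ * -Real.log (L ^ 4 * Real.exp (-c)) ↔ 1 < κ₁ * (c - 4 * Real.log L) := by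
  rw [neg_log_entropyActivityRate c hL]

end Folklore

/-! ## §2  At dag-n20-d's key-reading edition, ANY step-preserving dial, the level-cut bad reading: the survival design rule with generic summability and with a LOG age floor -/
section Survival
variable (θ : Stage13HParams F N) (hP : θ.Provisos₁₃CoPH F N) (K₀ : ℕ) (g₀ : ℕ → ℝ) (os : List (ULoop F)) (krR : KeyReading₁₃ N K₀) (jcut : ℕ → ℕ)
  (sh : ShellSplit₁₃CoPH N K₀) (hkr : ∀ (K : ℕ) (x : Σ K, SiteSeqKey F (K₀ + K)), x ∈ classSet₁₃ θ K₀ g₀ K → (krR F θ hP g₀ os K x).1 = K)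
  [DecidableEq (Σ K, SiteSeqKey F (K₀ + K))]
include hkr

/-- **★★ N20 AT A STEP-PRESERVING DIAL FROM THE SURVIVAL LETTER — GENERIC SUMMABILITY** (p617084 §1's majorant `W K ≤ V·r^{K₀+K−jcut K}∕(1−r)` + p610465 §1): per-stratum survival
domination at the coarse carriers, cut inside the window, `V·r^{age floor K} < 1 − r` at every step and `Σ_K V·r^{age floor K} < ∞` ⇒ `RelWeightBound` AT
`crOfRecord₁₃KAt K₀ kr (badKeyReadingOfCut₁₃ … jcut) sh F θ hP g₀ os`.  (p617084's `_ageFloor` rule is the linear-floor instance; §2's `_logAgeFloor` the logarithmic one.)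
[cite: Balaban1989LargeFieldII, Thm 1 + (0.1) pp.355–356, (1.80) p.384, (1.89) p.387; King1986, (3.10)–(3.11) p.656 (bookkeeping)] -/
theorem relWeightBound_crOfRecord₁₃KAt_of_survival {r V : ℝ} (h0 : 0 < r) (h1 : r < 1) (hV : 0 ≤ V) (hwin : ∀ K, jcut K ≤ K₀ + K)
    (hone : ∀ K, V * r ^ (K₀ + K - jcut K) < 1 - r) (hsum : Summable fun K => V * r ^ (K₀ + K - jcut K))
    (hA : ∀ (K : ℕ) (t : ℝ), |t| ≤ 1 → ∀ j < jcut K,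
      ∑ u ∈ badClassK₁₃ θ K₀ g₀ (krR F θ hP g₀ os) (fun _ x => KeyOldLargeField ((fun _ : ℕ => j + 1) x.1) x.2) K t \
          badClassK₁₃ θ K₀ g₀ (krR F θ hP g₀ os) (fun _ x => KeyOldLargeField ((fun _ : ℕ => j) x.1) x.2) K t, weightAK₁₃ θ hP K₀ g₀ os (krR F θ hP g₀ os) K t u ≤
        V * r ^ (K₀ + K - (j + 1)) * ∑ u ∈ classSetK₁₃ θ K₀ g₀ (krR F θ hP g₀ os) K, weightAK₁₃ θ hP K₀ g₀ os (krR F θ hP g₀ os) K t u)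
    (hB : ∀ (K : ℕ) (t : ℝ), |t| ≤ 1 → ∀ j < jcut K,
      ∑ u ∈ badClassK₁₃ θ K₀ g₀ (krR F θ hP g₀ os) (fun _ x => KeyOldLargeField ((fun _ : ℕ => j + 1) x.1) x.2) K t \
          badClassK₁₃ θ K₀ g₀ (krR F θ hP g₀ os) (fun _ x => KeyOldLargeField ((fun _ : ℕ => j) x.1) x.2) K t, weightBK₁₃ θ hP K₀ g₀ os (krR F θ hP g₀ os) K t u ≤
        V * r ^ (K₀ + K - (j + 1)) * ∑ u ∈ classSetK₁₃ θ K₀ g₀ (krR F θ hP g₀ os) K, weightBK₁₃ θ hP K₀ g₀ os (krR F θ hP g₀ os) K t u) :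
    RelWeightBound (crOfRecord₁₃KAt K₀ krR (badKeyReadingOfCut₁₃ N K₀ jcut) sh F θ hP g₀ os).l₀ (crOfRecord₁₃KAt K₀ krR (badKeyReadingOfCut₁₃ N K₀ jcut) sh F θ hP g₀ os).T
      (crOfRecord₁₃KAt K₀ krR (badKeyReadingOfCut₁₃ N K₀ jcut) sh F θ hP g₀ os).A (crOfRecord₁₃KAt K₀ krR (badKeyReadingOfCut₁₃ N K₀ jcut) sh F θ hP g₀ os).B
      (crOfRecord₁₃KAt K₀ krR (badKeyReadingOfCut₁₃ N K₀ jcut) sh F θ hP g₀ os).Bad (crOfRecord₁₃KAt K₀ krR (badKeyReadingOfCut₁₃ N K₀ jcut) sh F θ hP g₀ os).W := by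
  have h1r : 0 < 1 - r := sub_pos.2 h1
  have hle : ∀ K, (crOfRecord₁₃KAt K₀ krR (badKeyReadingOfCut₁₃ N K₀ jcut) sh F θ hP g₀ os).W K ≤ V * r ^ (K₀ + K - jcut K) / (1 - r) := fun K =>
    W_crOfRecord₁₃KAt_le_survival θ hP K₀ g₀ os krR jcut sh hkr h0.le h1 hV K (hwin K) (hA K) (hB K)
  refine (relWeightBound_crOfRecord₁₃KAt_iff θ hP K₀ g₀ os krR (badKeyReadingOfCut₁₃ N K₀ jcut) sh).2 ⟨fun K => (hle K).trans_lt ((div_lt_one h1r).2 (hone K)), ?_⟩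
  exact Summable.of_nonneg_of_le (fun K => wInf_nonneg K) hle (hsum.div_const (1 - r))

/-- **★★ N20 AT A STEP-PRESERVING DIAL FROM THE SURVIVAL LETTER WITH A LOGARITHMIC AGE FLOOR — THE LOG-MARGIN DESIGN RULE**: rate `0 < r < 1`, entropy `V ≥ 0`, minimal age `a₀` with
`V·r^{a₀} < 1 − r`, margin `1 < κ·(−log r)`, a cut inside the window whose age floor is `≥ a₀` and `≥ κ·log K` at every step, and the per-stratum survival
domination at the coarse carriers ⇒ `RelWeightBound` AT `crOfRecord₁₃KAt K₀ kr (badKeyReadingOfCut₁₃ … jcut) sh F θ hP g₀ os` (the cards' `jcut K = K₀ + K − (bud + κ₁ log K)`).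
[cite: Balaban1989LargeFieldII, Thm 1 + (0.1) pp.355–356, (1.80) p.384, (1.85) p.386, (1.89) p.387; King1986, (3.10)–(3.11) p.656 (bookkeeping)] -/
theorem relWeightBound_crOfRecord₁₃KAt_of_survival_logAgeFloor {r V κ : ℝ} {a₀ : ℕ} (h0 : 0 < r) (h1 : r < 1) (hV : 0 ≤ V)
    (hthr : V * r ^ a₀ < 1 - r) (hmargin : 1 < κ * -Real.log r) (hwin : ∀ K, jcut K ≤ K₀ + K) (hfloor : ∀ K, a₀ ≤ K₀ + K - jcut K)
    (hlog : ∀ K : ℕ, κ * Real.log (K : ℝ) ≤ ((K₀ + K - jcut K : ℕ) : ℝ))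
    (hA : ∀ (K : ℕ) (t : ℝ), |t| ≤ 1 → ∀ j < jcut K,
      ∑ u ∈ badClassK₁₃ θ K₀ g₀ (krR F θ hP g₀ os) (fun _ x => KeyOldLargeField ((fun _ : ℕ => j + 1) x.1) x.2) K t \
          badClassK₁₃ θ K₀ g₀ (krR F θ hP g₀ os) (fun _ x => KeyOldLargeField ((fun _ : ℕ => j) x.1) x.2) K t, weightAK₁₃ θ hP K₀ g₀ os (krR F θ hP g₀ os) K t u ≤
        V * r ^ (K₀ + K - (j + 1)) * ∑ u ∈ classSetK₁₃ θ K₀ g₀ (krR F θ hP g₀ os) K, weightAK₁₃ θ hP K₀ g₀ os (krR F θ hP g₀ os) K t u)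
    (hB : ∀ (K : ℕ) (t : ℝ), |t| ≤ 1 → ∀ j < jcut K,
      ∑ u ∈ badClassK₁₃ θ K₀ g₀ (krR F θ hP g₀ os) (fun _ x => KeyOldLargeField ((fun _ : ℕ => j + 1) x.1) x.2) K t \
          badClassK₁₃ θ K₀ g₀ (krR F θ hP g₀ os) (fun _ x => KeyOldLargeField ((fun _ : ℕ => j) x.1) x.2) K t, weightBK₁₃ θ hP K₀ g₀ os (krR F θ hP g₀ os) K t u ≤
        V * r ^ (K₀ + K - (j + 1)) * ∑ u ∈ classSetK₁₃ θ K₀ g₀ (krR F θ hP g₀ os) K, weightBK₁₃ θ hP K₀ g₀ os (krR F θ hP g₀ os) K t u) :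
    RelWeightBound (crOfRecord₁₃KAt K₀ krR (badKeyReadingOfCut₁₃ N K₀ jcut) sh F θ hP g₀ os).l₀ (crOfRecord₁₃KAt K₀ krR (badKeyReadingOfCut₁₃ N K₀ jcut) sh F θ hP g₀ os).T
      (crOfRecord₁₃KAt K₀ krR (badKeyReadingOfCut₁₃ N K₀ jcut) sh F θ hP g₀ os).A (crOfRecord₁₃KAt K₀ krR (badKeyReadingOfCut₁₃ N K₀ jcut) sh F θ hP g₀ os).B
      (crOfRecord₁₃KAt K₀ krR (badKeyReadingOfCut₁₃ N K₀ jcut) sh F θ hP g₀ os).Bad (crOfRecord₁₃KAt K₀ krR (badKeyReadingOfCut₁₃ N K₀ jcut) sh F θ hP g₀ os).W :=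
  relWeightBound_crOfRecord₁₃KAt_of_survival θ hP K₀ g₀ os krR jcut sh hkr h0 h1 hV hwin
    (fun K => (mul_le_mul_of_nonneg_left (pow_le_pow_of_le_one h0.le h1.le (hfloor K)) hV).trans_lt hthr)
    (summable_survival_of_logAgeFloor h0 h1 hV hmargin hlog) hA hB

end Survival

/-! ## §3  At the NAMED forgiving key: the cards' OVER-AGE booking with the log margin; the pending dial (P) under a log age floor -/
section Forgive
variable (θ : Stage13HParams F N) (hP : θ.Provisos₁₃CoPH F N) (K₀ : ℕ) (g₀ : ℕ → ℝ) (os : List (ULoop F)) (cR : FloorReading₁₃ N) (jcut : ℕ → ℕ) (sh : ShellSplit₁₃CoPH N K₀)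
  [DecidableEq (Σ K, SiteSeqKey F (K₀ + K))]

/-- **★★★ THE CARDS' OVER-AGE BOOKING, TYPED — N20 AT THE COMPONENT-FORGIVING KEY FROM THE SURVIVAL LETTER WITH THE LOG MARGIN**: at `forgiveCompReading₁₃ K₀ cR` the level-cut bad reading
with cut `jcut K` books «an UN-ABSORBED birth at a window level `≤ jcut K`», i.e. a pending region OLDER than the age floor `K₀ + K − jcut K` (p617084 `forgive_mem_badClassK₁₃_cut_iff_unabsorbed`);
the per-birth-level survival letter at rate `r` (the cards' `L⁴e^{−c}`, §1) with entropy `V`, a minimal age `a₀` (`V·r^{a₀} < 1 − r`) and the LOG margin (`κ·log K ≤` age floor, `1 < κ·(−log r)`,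
i.e. `1 < κ₁·(c − 4 log L)` by `logMargin_iff`) ⇒ the N20 face there.  HYPOTHESIS = the cards' derived one-run letter made relative and two-run (NE7b's body, NAMED OPEN).
[cite: Balaban1989LargeFieldII, Thm 1 + (0.1) pp.355–356, (1.79)–(1.85) pp.383–386, (1.89) p.387; Balaban1989LargeFieldI, p.177; King1986, (3.10)–(3.11) p.656 (bookkeeping)] -/
theorem relWeightBound_forgiveCompReading₁₃_of_survival_logAgeFloor {r V κ : ℝ} {a₀ : ℕ} (h0 : 0 < r) (h1 : r < 1) (hV : 0 ≤ V)
    (hthr : V * r ^ a₀ < 1 - r) (hmargin : 1 < κ * -Real.log r) (hwin : ∀ K, jcut K ≤ K₀ + K) (hfloor : ∀ K, a₀ ≤ K₀ + K - jcut K)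
    (hlog : ∀ K : ℕ, κ * Real.log (K : ℝ) ≤ ((K₀ + K - jcut K : ℕ) : ℝ))
    (hA : ∀ (K : ℕ) (t : ℝ), |t| ≤ 1 → ∀ j < jcut K,
      ∑ u ∈ badClassK₁₃ θ K₀ g₀ (forgiveCompReading₁₃ K₀ cR F θ hP g₀ os) (fun _ x => KeyOldLargeField ((fun _ : ℕ => j + 1) x.1) x.2) K t \
          badClassK₁₃ θ K₀ g₀ (forgiveCompReading₁₃ K₀ cR F θ hP g₀ os) (fun _ x => KeyOldLargeField ((fun _ : ℕ => j) x.1) x.2) K t,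
          weightAK₁₃ θ hP K₀ g₀ os (forgiveCompReading₁₃ K₀ cR F θ hP g₀ os) K t u ≤
        V * r ^ (K₀ + K - (j + 1)) * ∑ u ∈ classSetK₁₃ θ K₀ g₀ (forgiveCompReading₁₃ K₀ cR F θ hP g₀ os) K,
          weightAK₁₃ θ hP K₀ g₀ os (forgiveCompReading₁₃ K₀ cR F θ hP g₀ os) K t u)
    (hB : ∀ (K : ℕ) (t : ℝ), |t| ≤ 1 → ∀ j < jcut K,
      ∑ u ∈ badClassK₁₃ θ K₀ g₀ (forgiveCompReading₁₃ K₀ cR F θ hP g₀ os) (fun _ x => KeyOldLargeField ((fun _ : ℕ => j + 1) x.1) x.2) K t \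
          badClassK₁₃ θ K₀ g₀ (forgiveCompReading₁₃ K₀ cR F θ hP g₀ os) (fun _ x => KeyOldLargeField ((fun _ : ℕ => j) x.1) x.2) K t,
          weightBK₁₃ θ hP K₀ g₀ os (forgiveCompReading₁₃ K₀ cR F θ hP g₀ os) K t u ≤
        V * r ^ (K₀ + K - (j + 1)) * ∑ u ∈ classSetK₁₃ θ K₀ g₀ (forgiveCompReading₁₃ K₀ cR F θ hP g₀ os) K,
          weightBK₁₃ θ hP K₀ g₀ os (forgiveCompReading₁₃ K₀ cR F θ hP g₀ os) K t u) :
    RelWeightBound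
      (crOfRecord₁₃KAt K₀ (forgiveCompReading₁₃ K₀ cR) (badKeyReadingOfCut₁₃ N K₀ jcut) sh F θ hP g₀ os).l₀
      (crOfRecord₁₃KAt K₀ (forgiveCompReading₁₃ K₀ cR) (badKeyReadingOfCut₁₃ N K₀ jcut) sh F θ hP g₀ os).T
      (crOfRecord₁₃KAt K₀ (forgiveCompReading₁₃ K₀ cR) (badKeyReadingOfCut₁₃ N K₀ jcut) sh F θ hP g₀ os).A
      (crOfRecord₁₃KAt K₀ (forgiveCompReading₁₃ K₀ cR) (badKeyReadingOfCut₁₃ N K₀ jcut) sh F θ hP g₀ os).B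
      (crOfRecord₁₃KAt K₀ (forgiveCompReading₁₃ K₀ cR) (badKeyReadingOfCut₁₃ N K₀ jcut) sh F θ hP g₀ os).Bad
      (crOfRecord₁₃KAt K₀ (forgiveCompReading₁₃ K₀ cR) (badKeyReadingOfCut₁₃ N K₀ jcut) sh F θ hP g₀ os).W :=
  relWeightBound_crOfRecord₁₃KAt_of_survival_logAgeFloor θ hP K₀ g₀ os (forgiveCompReading₁₃ K₀ cR) jcut sh
    (fun K x hx => forgiveKeyCompSigma_fst_eq θ K₀ g₀ (cR F θ hP g₀ os) K x hx) h0 h1 hV hthr hmargin hwin hfloor hlog hA hB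

/-- **★★★ … IN THE CARDS' OWN LETTERS** (`r := L⁴·e^{−c}` substituted): block base `L > 0`, over-age rate `c` with `4 log L < c` (so `r < 1`, `entropyActivityRate_lt_one_iff`), margin slope
`κ₁` with `1 < κ₁·(c − 4 log L)` (`logMargin_iff`), entropy `V ≥ 0` and minimal age `a₀` with `V·r^{a₀} < 1 − r`, the window (cut `≤ K₀+K`) with age floor `≥ a₀` and `≥ κ₁ log K`, and the
per-birth-level survival domination at rate `r` at the coarse carriers of the forgiving key ⇒ the N20 face there.  The numbers are the memo's; the letter is the hypothesis (NAMED OPEN).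
[cite: Balaban1989LargeFieldII, Thm 1 + (0.1) pp.355–356, (1.79)–(1.85) pp.383–386; Balaban1989LargeFieldI, p.177; King1986, (3.10)–(3.11) p.656 (bookkeeping)] -/
theorem relWeightBound_forgiveCompReading₁₃_of_overAgeRate {L c κ₁ V : ℝ} {a₀ : ℕ} (hL : 0 < L) (hc : 4 * Real.log L < c) (hmargin : 1 < κ₁ * (c - 4 * Real.log L)) (hV : 0 ≤ V)
    (hthr : V * (L ^ 4 * Real.exp (-c)) ^ a₀ < 1 - L ^ 4 * Real.exp (-c)) (hwin : ∀ K, jcut K ≤ K₀ + K) (hfloor : ∀ K, a₀ ≤ K₀ + K - jcut K)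
    (hlog : ∀ K : ℕ, κ₁ * Real.log (K : ℝ) ≤ ((K₀ + K - jcut K : ℕ) : ℝ))
    (hA : ∀ (K : ℕ) (t : ℝ), |t| ≤ 1 → ∀ j < jcut K,
      ∑ u ∈ badClassK₁₃ θ K₀ g₀ (forgiveCompReading₁₃ K₀ cR F θ hP g₀ os) (fun _ x => KeyOldLargeField ((fun _ : ℕ => j + 1) x.1) x.2) K t \
          badClassK₁₃ θ K₀ g₀ (forgiveCompReading₁₃ K₀ cR F θ hP g₀ os) (fun _ x => KeyOldLargeField ((fun _ : ℕ => j) x.1) x.2) K t,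
          weightAK₁₃ θ hP K₀ g₀ os (forgiveCompReading₁₃ K₀ cR F θ hP g₀ os) K t u ≤
        V * (L ^ 4 * Real.exp (-c)) ^ (K₀ + K - (j + 1)) * ∑ u ∈ classSetK₁₃ θ K₀ g₀ (forgiveCompReading₁₃ K₀ cR F θ hP g₀ os) K,
          weightAK₁₃ θ hP K₀ g₀ os (forgiveCompReading₁₃ K₀ cR F θ hP g₀ os) K t u)
    (hB : ∀ (K : ℕ) (t : ℝ), |t| ≤ 1 → ∀ j < jcut K,
      ∑ u ∈ badClassK₁₃ θ K₀ g₀ (forgiveCompReading₁₃ K₀ cR F θ hP g₀ os) (fun _ x => KeyOldLargeField ((fun _ : ℕ => j + 1) x.1) x.2) K t \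
          badClassK₁₃ θ K₀ g₀ (forgiveCompReading₁₃ K₀ cR F θ hP g₀ os) (fun _ x => KeyOldLargeField ((fun _ : ℕ => j) x.1) x.2) K t,
          weightBK₁₃ θ hP K₀ g₀ os (forgiveCompReading₁₃ K₀ cR F θ hP g₀ os) K t u ≤
        V * (L ^ 4 * Real.exp (-c)) ^ (K₀ + K - (j + 1)) * ∑ u ∈ classSetK₁₃ θ K₀ g₀ (forgiveCompReading₁₃ K₀ cR F θ hP g₀ os) K,
          weightBK₁₃ θ hP K₀ g₀ os (forgiveCompReading₁₃ K₀ cR F θ hP g₀ os) K t u) :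
    RelWeightBound
      (crOfRecord₁₃KAt K₀ (forgiveCompReading₁₃ K₀ cR) (badKeyReadingOfCut₁₃ N K₀ jcut) sh F θ hP g₀ os).l₀
      (crOfRecord₁₃KAt K₀ (forgiveCompReading₁₃ K₀ cR) (badKeyReadingOfCut₁₃ N K₀ jcut) sh F θ hP g₀ os).T
      (crOfRecord₁₃KAt K₀ (forgiveCompReading₁₃ K₀ cR) (badKeyReadingOfCut₁₃ N K₀ jcut) sh F θ hP g₀ os).A
      (crOfRecord₁₃KAt K₀ (forgiveCompReading₁₃ K₀ cR) (badKeyReadingOfCut₁₃ N K₀ jcut) sh F θ hP g₀ os).B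
      (crOfRecord₁₃KAt K₀ (forgiveCompReading₁₃ K₀ cR) (badKeyReadingOfCut₁₃ N K₀ jcut) sh F θ hP g₀ os).Bad
      (crOfRecord₁₃KAt K₀ (forgiveCompReading₁₃ K₀ cR) (badKeyReadingOfCut₁₃ N K₀ jcut) sh F θ hP g₀ os).W :=
  have h0 : 0 < L ^ 4 * Real.exp (-c) := mul_pos (pow_pos hL 4) (Real.exp_pos _)
  relWeightBound_forgiveCompReading₁₃_of_survival_logAgeFloor θ hP K₀ g₀ os cR jcut sh h0 ((entropyActivityRate_lt_one_iff hL).2 hc) hV hthr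
    ((logMargin_iff hL).2 hmargin) hwin hfloor hlog hA hB

variable (krR : KeyReading₁₃ N K₀) (bdP : BadKeyReading₁₃ N K₀)
  (φR : ℕ → (F : T4Family) → (θ : Stage13HParams F N) → θ.Provisos₁₃CoPH F N → (ℕ → ℝ) → List (ULoop F) → ℕ → (Σ K, SiteSeqKey F (K₀ + K)) → ℕ)
  (nR : ℕ → FloorReading₁₃ N)
  (hbd : ∀ K, ∀ u ∈ classSetK₁₃ θ K₀ g₀ (krR F θ hP g₀ os) K,
    (bdP F θ hP g₀ os K u ↔ ∃ j ∈ Finset.range (jcut K), nR j F θ hP g₀ os K ≤ φR j F θ hP g₀ os K u))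
include hbd

/-- **THE PENDING DIAL (P) OF p622010 UNDER A LOG AGE FLOOR** (any dial): constant threshold floor `n₀`, slope `c ≥ 1`, minimal age `a₀` with `V·q^{n₀}·(q^c)^{a₀} < (1−q)(1−q^c)`, margin
`1 < κ·(−log(q^c))`, age floor `≥ a₀` and `≥ κ·log K` ⇒ the face (p622010 `relWeightBound_crOfRecord₁₃KAt_pending_of_geometric` + §1's `p`-series at rate `q^c`).
[cite: Balaban1989LargeFieldII, Thm 1 + (0.1) pp.355–356, (1.80) p.384, (1.89) p.387; King1986, (3.10)–(3.11) p.656 (bookkeeping)] -/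
theorem relWeightBound_crOfRecord₁₃KAt_pending_of_geometric_logAge {q V κ : ℝ} (h0 : 0 < q) (h1 : q < 1) (hV : 0 ≤ V) {c : ℕ} (hc : 1 ≤ c) {n₀ a₀ : ℕ}
    (hwin : ∀ K, jcut K ≤ K₀ + K) (hlin : ∀ K, ∀ j < jcut K, n₀ + c * (K₀ + K - (j + 1)) ≤ nR j F θ hP g₀ os K)
    (hthr : V * q ^ n₀ * (q ^ c) ^ a₀ < (1 - q) * (1 - q ^ c)) (hmargin : 1 < κ * -Real.log (q ^ c)) (hfloor : ∀ K, a₀ ≤ K₀ + K - jcut K)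
    (hlog : ∀ K : ℕ, κ * Real.log (K : ℝ) ≤ ((K₀ + K - jcut K : ℕ) : ℝ))
    (hA : ∀ K, ∀ j < jcut K, ∀ t : ℝ, |t| ≤ 1 → ∀ m, nR j F θ hP g₀ os K ≤ m →
      ∑ u ∈ (classSetK₁₃ θ K₀ g₀ (krR F θ hP g₀ os) K).filter (fun u => φR j F θ hP g₀ os K u = m), weightAK₁₃ θ hP K₀ g₀ os (krR F θ hP g₀ os) K t u ≤
        V * q ^ m * ∑ u ∈ classSetK₁₃ θ K₀ g₀ (krR F θ hP g₀ os) K, weightAK₁₃ θ hP K₀ g₀ os (krR F θ hP g₀ os) K t u)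
    (hB : ∀ K, ∀ j < jcut K, ∀ t : ℝ, |t| ≤ 1 → ∀ m, nR j F θ hP g₀ os K ≤ m →
      ∑ u ∈ (classSetK₁₃ θ K₀ g₀ (krR F θ hP g₀ os) K).filter (fun u => φR j F θ hP g₀ os K u = m), weightBK₁₃ θ hP K₀ g₀ os (krR F θ hP g₀ os) K t u ≤
        V * q ^ m * ∑ u ∈ classSetK₁₃ θ K₀ g₀ (krR F θ hP g₀ os) K, weightBK₁₃ θ hP K₀ g₀ os (krR F θ hP g₀ os) K t u) :
    RelWeightBound (crOfRecord₁₃KAt K₀ krR bdP sh F θ hP g₀ os).l₀ (crOfRecord₁₃KAt K₀ krR bdP sh F θ hP g₀ os).T (crOfRecord₁₃KAt K₀ krR bdP sh F θ hP g₀ os).A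
      (crOfRecord₁₃KAt K₀ krR bdP sh F θ hP g₀ os).B (crOfRecord₁₃KAt K₀ krR bdP sh F θ hP g₀ os).Bad (crOfRecord₁₃KAt K₀ krR bdP sh F θ hP g₀ os).W := by
  have hr0 : 0 < q ^ c := pow_pos h0 c
  have hr1 : q ^ c < 1 := pow_lt_one₀ h0.le h1 (by omega)
  have hVn : 0 ≤ V * q ^ n₀ := mul_nonneg hV (pow_nonneg h0.le _)
  refine relWeightBound_crOfRecord₁₃KAt_pending_of_geometric θ hP K₀ g₀ os krR bdP sh φR nR jcut hbd h0.le h1 hV hc (fun _ => n₀) hwin hlin (fun K => ?_) ?_ hA hB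
  · exact (mul_le_mul_of_nonneg_left (pow_le_pow_of_le_one hr0.le hr1.le (hfloor K)) hVn).trans_lt hthr
  · exact summable_survival_of_logAgeFloor hr0 hr1 hVn hmargin hlog

end Forgive

end Summit.QuantumFields.YangMills.BalabanUVNodes.N20KeyedRelWeightLogMargin

end
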